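import Summits.QuantumFields.BalabanUV.Beta.ResolventCoeffAtomic

/-!
# Beta / ResolventCoeffAtomicSums — THE COEFFICIENT HYPOTHESIS FROM ATOMIC NORM TABLES, part 2: tables as association lists in canonical key
# order, every weighted sum a list fold decided by the kernel, and the END `coeff_sums_of_atomic` (β sub-cell, BINDER-OWNERS row CAP-k, lineage
# `b2b-balaban-beta-an5`, gen 29; node BETA-an5-g29-FIRSTLEAF, item «COEFFHYP-ATOMIC»; sequel of `ResolventCoeffAtomic`)

* §4 `monomialQ` (+ cast), `lookupQ` + `lookupQ_eq_of_mem` (duplicate-free keys), `wSumQ` ∕ `hiSumQ` (+ casts), `keyed_sum_le`, and the END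
  **`coeff_sums_of_atomic`**: ATOMIC program-side facts `‖Z e.1‖ ≤ e.2` (entries of `zFL`, keys `degLTList d mP` = T_P) and `‖residualCoeff … e.1‖ ≤ e.2`
  (entries of `ElL`, keys `degLTList d (N₀+1)` = the LOW multi-indices) + KERNEL checks (one `checkUB` per entry of the `‖taylorCoeff κ‖` table `TnL`, and
  the two rational inequalities `wSumQ h zFL ≤ p`, `wSumQ h ElL + hiSumQ N₀ h zFL TnL ≤ ε`) ⟹ the literal `hP ∧ hE` pair of `box_certificate_taylor_ofCoeffs` ∕
  `ResidualLeafRecord.certifies_ofCoeffs(_ofTableNorms)` with `T_P = degLT d mP`.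
* §5 kernel sanity: `|degLTList 3 6| = 126`, `|degLTList 3 7| = 210`, `|degLTList 3 9| = 495` — the engines' index counts (DCOEFF ∕ xdcoeff ∕ COEFF2).

HONEST FRAMING.  Kernel glue ([folklore]); no table, no number, no box supplied; it changes the GRANULARITY of the program-side qualifier of a certified
leaf (atomic norm facts about explicit matrices instead of two aggregate sums), not its nature.  0 binders of the real row instantiated; 0 certified
coefficients; discharging `BetaPertH` would make Bałaban's ultraviolet stability UNCONDITIONAL — NOT the continuum limit, NOT the Clay problem.  HONEST
DEPENDENCY: continuum YM on T⁴ ⇐ BetaPertH ∧ nine spine estimates (0∕9 proved); BetaPertH ⇐ (D1) ∧ (D4) ∧ CAP+tail; G-an2-4 gates asym, D1 and NE2∕3∕4.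
0 `sorry`, 0 cite tags.
-/

namespace Summit.QuantumFields.BalabanUV.Beta.ResolventBoxCertificate

open Complex Set Matrix Finset
open Summit.QuantumFields.BalabanUV.Beta.PolyRegularAlgebra (character)
open Summit.QuantumFields.BalabanUV.Beta.StencilExpSums
open Literature.Analysis.ValidatedNumerics.ExpSum (ETerm esum checkUB esum_le_of_checkUB)
open scoped Real Matrix.Norms.L2Operator Pointwise

noncomputable section

variable {d : ℕ} {n : Type*} [Fintype n] [DecidableEq n] [DecidableEq (Fin (d + 1) → ℕ)]

/-! ## §4 The computational layer: tables as association lists in canonical key order; every sum a list fold -/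

omit [Fintype n] [DecidableEq n] [DecidableEq (Fin (d + 1) → ℕ)] in
/-- the rational monomial `Π_μ h_μ^{β_μ}`. [folklore] -/
def monomialQ (β : Fin (d + 1) → ℕ) (h : Fin (d + 1) → ℚ) : ℚ := ∏ μ, h μ ^ β μ

omit [Fintype n] [DecidableEq n] [DecidableEq (Fin (d + 1) → ℕ)] in
/-- cast of `monomialQ`. [folklore] -/
theorem cast_monomialQ (β : Fin (d + 1) → ℕ) (h : Fin (d + 1) → ℚ) :
    ((monomialQ β h : ℚ) : ℝ) = monomial β (fun μ => ((h μ : ℚ) : ℝ)) := by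
  simp [monomialQ, monomial]

omit [Fintype n] [DecidableEq n] [DecidableEq (Fin (d + 1) → ℕ)] in
/-- `monomialQ ≥ 0` for non-negative `h`. [folklore] -/
theorem monomialQ_nonneg (β : Fin (d + 1) → ℕ) {h : Fin (d + 1) → ℚ} (hh : ∀ μ, 0 ≤ h μ) : 0 ≤ monomialQ β h :=
  Finset.prod_nonneg fun μ _ => pow_nonneg (hh μ) _

/-- lookup in an association list keyed by multi-indices (`0` if absent). [folklore] -/
def lookupQ : List ((Fin (d + 1) → ℕ) × ℚ) → (Fin (d + 1) → ℕ) → ℚ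
  | [], _ => 0
  | e :: T, β => if e.1 = β then e.2 else lookupQ T β

/-- with pairwise distinct keys, the lookup of an entry's key returns that entry's value. [folklore] -/
theorem lookupQ_eq_of_mem : ∀ {T : List ((Fin (d + 1) → ℕ) × ℚ)}, (T.map Prod.fst).Nodup →
    ∀ {e : (Fin (d + 1) → ℕ) × ℚ}, e ∈ T → lookupQ T e.1 = e.2
  | [], _, e, he => absurd he List.not_mem_nil
  | a :: T, hnd, e, he => by
    rw [List.map_cons, List.nodup_cons] at hnd
    rcases List.mem_cons.mp he with rfl | he'
    · simp [lookupQ]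
    · have hne : a.1 ≠ e.1 := fun hae => hnd.1 (hae ▸ List.mem_map.mpr ⟨e, he', rfl⟩)
      rw [lookupQ, if_neg hne]
      exact lookupQ_eq_of_mem hnd.2 he'

omit [DecidableEq (Fin (d + 1) → ℕ)] in
/-- an entry for every key of the key list. [folklore] -/
theorem exists_entry_of_mem_keys {T : List ((Fin (d + 1) → ℕ) × ℚ)} {Kl : List (Fin (d + 1) → ℕ)} (hK : T.map Prod.fst = Kl)
    {β : Fin (d + 1) → ℕ} (hβ : β ∈ Kl) : ∃ e ∈ T, e.1 = β := by
  rw [← hK, List.mem_map] at hβ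
  exact hβ

/-- the weighted table sum `Σ_e h^{e.1} · e.2` (as a rational). [folklore] -/
def wSumQ (h : Fin (d + 1) → ℚ) (T : List ((Fin (d + 1) → ℕ) × ℚ)) : ℚ := (T.map fun e => monomialQ e.1 h * e.2).sum

/-- the HIGH double sum `Σ_{e ∈ zFL} Σ_{e' ∈ TnL} [|e.1 + e'.1| > N₀] h^{e.1} e.2 · h^{e'.1} e'.2` (as a rational). [folklore] -/
def hiSumQ (N₀ : ℕ) (h : Fin (d + 1) → ℚ) (zFL TnL : List ((Fin (d + 1) → ℕ) × ℚ)) : ℚ :=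
  (zFL.map fun e => (TnL.map fun e' =>
    if ∑ μ, (e.1 μ + e'.1 μ) ≤ N₀ then 0 else monomialQ e.1 h * e.2 * (monomialQ e'.1 h * e'.2)).sum).sum

omit [Fintype n] [DecidableEq n] [DecidableEq (Fin (d + 1) → ℕ)] in
/-- cast of the weighted table sum. [folklore] -/
theorem cast_wSumQ (h : Fin (d + 1) → ℚ) (T : List ((Fin (d + 1) → ℕ) × ℚ)) :
    ((wSumQ h T : ℚ) : ℝ) = (T.map fun e => monomial e.1 (fun μ => ((h μ : ℚ) : ℝ)) * ((e.2 : ℚ) : ℝ)).sum := by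
  induction T with
  | nil => simp [wSumQ]
  | cons e T ih =>
    simp only [wSumQ, List.map_cons, List.sum_cons, Rat.cast_add, Rat.cast_mul, cast_monomialQ] at ih ⊢
    rw [ih]

omit [Fintype n] [DecidableEq n] [DecidableEq (Fin (d + 1) → ℕ)] in
/-- cast of the high double sum. [folklore] -/
theorem cast_hiSumQ (N₀ : ℕ) (h : Fin (d + 1) → ℚ) (zFL TnL : List ((Fin (d + 1) → ℕ) × ℚ)) :
    ((hiSumQ N₀ h zFL TnL : ℚ) : ℝ) = (zFL.map fun e => (TnL.map fun e' =>
      if ∑ μ, (e.1 μ + e'.1 μ) ≤ N₀ then (0 : ℝ) else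
        monomial e.1 (fun μ => ((h μ : ℚ) : ℝ)) * ((e.2 : ℚ) : ℝ) * (monomial e'.1 (fun μ => ((h μ : ℚ) : ℝ)) * ((e'.2 : ℚ) : ℝ))).sum).sum := by
  unfold hiSumQ
  rw [Rat.cast_list_sum, List.map_map]
  refine congrArg List.sum (List.map_congr_left fun e _ => ?_)
  rw [Function.comp_apply, Rat.cast_list_sum, List.map_map]
  refine congrArg List.sum (List.map_congr_left fun e' _ => ?_)
  rw [Function.comp_apply]
  split_ifs <;> simp [cast_monomialQ]

omit [DecidableEq (Fin (d + 1) → ℕ)] in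
/-- a list sum is monotone under a pointwise bound along a key list: `(Kl.map f).sum ≤ (T.map g).sum` when `T.map fst = Kl` and `f e.1 ≤ g e`. [folklore] -/
theorem keyed_sum_le {T : List ((Fin (d + 1) → ℕ) × ℚ)} {Kl : List (Fin (d + 1) → ℕ)} (hK : T.map Prod.fst = Kl)
    (f : (Fin (d + 1) → ℕ) → ℝ) (g : (Fin (d + 1) → ℕ) × ℚ → ℝ) (hfg : ∀ e ∈ T, f e.1 ≤ g e) :
    (Kl.map f).sum ≤ (T.map g).sum := by
  rw [← hK, List.map_map]
  exact List.sum_le_sum fun e he => hfg e he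

/-- **THE END: THE TWO COEFFICIENT-NORM SUMS FROM ATOMIC TABLES + KERNEL CHECKS.**  Program-side (atomic, per index): `‖Z e.1‖ ≤ e.2` for the
entries of `zFL` (keys = `degLTList d mP` = T_P) and `‖residualCoeff … e.1‖ ≤ e.2` for the entries of `ElL` (keys = `degLTList d (N₀+1)` = the LOW
multi-indices).  Kernel-side: the `‖taylorCoeff κ‖` table `TnL` by ONE `checkUB` per entry, and the two rational inequalities `wSumQ h zFL ≤ p`,
`wSumQ h ElL + hiSumQ N₀ h zFL TnL ≤ ε` (tables in the canonical key order of `degLTList`, which is duplicate-free: `nodup_degLTList`).  Conclusion: the literal `hP ∧ hE` pair of `box_certificate_taylor_ofCoeffs` ∕ `certifies_ofCoeffs(_ofTableNorms)`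
with `T_P = degLT d mP`, half-widths `h`. [folklore] -/
theorem coeff_sums_of_atomic
    {L : List (Fin (d + 1) → ℤ)} {S : Finset (Fin (d + 1) → ℤ)} (hLS : L.toFinset = S)
    {K : (Fin (d + 1) → ℤ) → Matrix n n ℂ} {ν : (Fin (d + 1) → ℤ) → ℚ} (hν : ∀ x ∈ S, ‖K x‖ ≤ ν x)
    {c : Fin (d + 1) → ℂ} {cIm : Fin (d + 1) → ℚ} (hc : ∀ μ, (c μ).im = ((cIm μ : ℚ) : ℝ))
    {h : Fin (d + 1) → ℚ} (hh : ∀ μ, 0 ≤ h μ)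
    (mP m N₀ : ℕ) (Z : (Fin (d + 1) → ℕ) → Matrix n n ℂ) (zFL ElL TnL : List ((Fin (d + 1) → ℕ) × ℚ))
    (hzK : zFL.map Prod.fst = degLTList d mP) (hEK : ElL.map Prod.fst = degLTList d (N₀ + 1)) (hTK : TnL.map Prod.fst = degLTList d m)
    (hZ : ∀ e ∈ zFL, ‖Z e.1‖ ≤ e.2)
    (hElo : ∀ e ∈ ElL, ‖residualCoeff (degLT d mP) Z m S K c e.1‖ ≤ e.2)
    {Sc Kt kt : ℕ} (hSc : 0 < Sc) (hTn : ∀ e ∈ TnL, checkUB Sc Kt kt (coeffTerms e.1 L ν cIm) e.2.num e.2.den = true)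
    {p ε : ℚ} (hP : wSumQ h zFL ≤ p) (hEsum : wSumQ h ElL + hiSumQ N₀ h zFL TnL ≤ ε) :
    (∑ β ∈ degLT d mP, monomial β (fun μ => ((h μ : ℚ) : ℝ)) * ‖Z β‖ ≤ ((p : ℚ) : ℝ)) ∧
    (∑ γ ∈ insert 0 (degLT d mP + degLT d m), monomial γ (fun μ => ((h μ : ℚ) : ℝ)) *
        ‖residualCoeff (degLT d mP) Z m S K c γ‖ ≤ ((ε : ℚ) : ℝ)) := by
  have hhr0 : ∀ μ, 0 ≤ (fun μ => ((h μ : ℚ) : ℝ)) μ := fun μ => by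
    show (0 : ℝ) ≤ ((h μ : ℚ) : ℝ); exact_mod_cast hh μ
  -- the three lookup functions and their specifications
  have hzF : ∀ β ∈ degLT d mP, ‖Z β‖ ≤ ((lookupQ zFL β : ℚ) : ℝ) := by
    intro β hβ
    obtain ⟨e, he, rfl⟩ := exists_entry_of_mem_keys hzK ((mem_degLTList).mpr (mem_degLT.mp hβ))
    rw [lookupQ_eq_of_mem (hzK ▸ nodup_degLTList d mP) he]; exact hZ e he
  have hTnf : ∀ κ ∈ degLT d m, ‖taylorCoeff S K c κ‖ ≤ ((lookupQ TnL κ : ℚ) : ℝ) := by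
    intro κ hκ
    obtain ⟨e, he, rfl⟩ := exists_entry_of_mem_keys hTK ((mem_degLTList).mpr (mem_degLT.mp hκ))
    rw [lookupQ_eq_of_mem (hTK ▸ nodup_degLTList d m) he]; exact norm_taylorCoeff_le_of_checkUB hLS hν hc e.1 hSc (hTn e he)
  have hEf : ∀ γ ∈ insert 0 (degLT d mP + degLT d m), ∑ μ, γ μ ≤ N₀ →
      ‖residualCoeff (degLT d mP) Z m S K c γ‖ ≤ ((lookupQ ElL γ : ℚ) : ℝ) := by
    intro γ _ hγ
    obtain ⟨e, he, rfl⟩ := exists_entry_of_mem_keys hEK ((mem_degLTList).mpr (Nat.lt_succ_of_le hγ))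
    rw [lookupQ_eq_of_mem (hEK ▸ nodup_degLTList d (N₀ + 1)) he]; exact hElo e he
  have hmemP : ∀ β ∈ degLTList d mP, β ∈ degLT d mP := fun β hβ => mem_degLT.mpr (mem_degLTList.mp hβ)
  have hmemT : ∀ κ ∈ degLTList d m, κ ∈ degLT d m := fun κ hκ => mem_degLT.mpr (mem_degLTList.mp hκ)
  have hmemE : ∀ γ ∈ degLTList d (N₀ + 1), γ ∈ degLT d (N₀ + 1) := fun γ hγ => mem_degLT.mpr (mem_degLTList.mp hγ)
  refine ⟨?_, ?_⟩
  · -- hP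
    calc ∑ β ∈ degLT d mP, monomial β (fun μ => ((h μ : ℚ) : ℝ)) * ‖Z β‖
        ≤ ((degLTList d mP).map fun β => monomial β (fun μ => ((h μ : ℚ) : ℝ)) * ‖Z β‖).sum :=
          sum_degLT_le_listSum mP _ fun β _ => mul_nonneg (monomial_nonneg β hhr0) (norm_nonneg _)
      _ ≤ (zFL.map fun e => monomial e.1 (fun μ => ((h μ : ℚ) : ℝ)) * ((e.2 : ℚ) : ℝ)).sum :=
          keyed_sum_le hzK _ _ fun e he => mul_le_mul_of_nonneg_left (hZ e he) (monomial_nonneg _ hhr0)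
      _ = ((wSumQ h zFL : ℚ) : ℝ) := (cast_wSumQ h zFL).symm
      _ ≤ ((p : ℚ) : ℝ) := by exact_mod_cast hP
  · -- hE
    have hmain := sum_residualCoeff_le_atomic (degLT d mP) Z m S K c hhr0 N₀
      (fun γ => ((lookupQ ElL γ : ℚ) : ℝ)) (fun β => ((lookupQ zFL β : ℚ) : ℝ)) (fun κ => ((lookupQ TnL κ : ℚ) : ℝ)) hEf hzF hTnf
    refine hmain.trans ?_
    have hε : ((wSumQ h ElL : ℚ) : ℝ) + ((hiSumQ N₀ h zFL TnL : ℚ) : ℝ) ≤ ((ε : ℚ) : ℝ) := by exact_mod_cast hEsum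
    refine le_trans (add_le_add ?_ ?_) hε
    · -- the LOW part
      have hsub : (insert 0 (degLT d mP + degLT d m)).filter (fun γ => ∑ μ, γ μ ≤ N₀) ⊆ degLT d (N₀ + 1) := by
        intro γ hγ
        rw [Finset.mem_filter] at hγ
        exact mem_degLT.mpr (Nat.lt_succ_of_le hγ.2)
      have hE0 : ∀ γ ∈ degLT d (N₀ + 1), 0 ≤ monomial γ (fun μ => ((h μ : ℚ) : ℝ)) * ((lookupQ ElL γ : ℚ) : ℝ) := by
        intro γ hγ
        obtain ⟨e, he, rfl⟩ := exists_entry_of_mem_keys hEK ((mem_degLTList).mpr (mem_degLT.mp hγ))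
        rw [lookupQ_eq_of_mem (hEK ▸ nodup_degLTList d (N₀ + 1)) he]
        exact mul_nonneg (monomial_nonneg _ hhr0) ((norm_nonneg _).trans (hElo e he))
      calc ∑ γ ∈ (insert 0 (degLT d mP + degLT d m)).filter (fun γ => ∑ μ, γ μ ≤ N₀), monomial γ (fun μ => ((h μ : ℚ) : ℝ)) * ((lookupQ ElL γ : ℚ) : ℝ)
          ≤ ∑ γ ∈ degLT d (N₀ + 1), monomial γ (fun μ => ((h μ : ℚ) : ℝ)) * ((lookupQ ElL γ : ℚ) : ℝ) :=
            Finset.sum_le_sum_of_subset_of_nonneg hsub fun γ hγ _ => hE0 γ hγ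
        _ ≤ ((degLTList d (N₀ + 1)).map fun γ => monomial γ (fun μ => ((h μ : ℚ) : ℝ)) * ((lookupQ ElL γ : ℚ) : ℝ)).sum :=
            sum_degLT_le_listSum (N₀ + 1) _ fun γ hγ => hE0 γ (hmemE γ hγ)
        _ ≤ (ElL.map fun e => monomial e.1 (fun μ => ((h μ : ℚ) : ℝ)) * ((e.2 : ℚ) : ℝ)).sum :=
            keyed_sum_le hEK _ _ fun e he => by rw [lookupQ_eq_of_mem (hEK ▸ nodup_degLTList d (N₀ + 1)) he]
        _ = ((wSumQ h ElL : ℚ) : ℝ) := (cast_wSumQ h ElL).symm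
    · -- the HIGH part
      have hzF0 : ∀ β ∈ degLT d mP, (0 : ℝ) ≤ ((lookupQ zFL β : ℚ) : ℝ) := fun β hβ => (norm_nonneg _).trans (hzF β hβ)
      have hTn0 : ∀ κ ∈ degLT d m, (0 : ℝ) ≤ ((lookupQ TnL κ : ℚ) : ℝ) := fun κ hκ => (norm_nonneg _).trans (hTnf κ hκ)
      have hF0 : ∀ β ∈ degLT d mP, ∀ κ ∈ degLT d m, 0 ≤ (if ∑ μ, (β + κ) μ ≤ N₀ then (0 : ℝ) else
          monomial β (fun μ => ((h μ : ℚ) : ℝ)) * ((lookupQ zFL β : ℚ) : ℝ) * (monomial κ (fun μ => ((h μ : ℚ) : ℝ)) * ((lookupQ TnL κ : ℚ) : ℝ))) := by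
        intro β hβ κ hκ
        split_ifs
        · exact le_rfl
        · exact mul_nonneg (mul_nonneg (monomial_nonneg _ hhr0) (hzF0 β hβ)) (mul_nonneg (monomial_nonneg _ hhr0) (hTn0 κ hκ))
      rw [cast_hiSumQ]
      calc ∑ β ∈ degLT d mP, ∑ κ ∈ degLT d m, (if ∑ μ, (β + κ) μ ≤ N₀ then (0 : ℝ) else
              monomial β (fun μ => ((h μ : ℚ) : ℝ)) * ((lookupQ zFL β : ℚ) : ℝ) * (monomial κ (fun μ => ((h μ : ℚ) : ℝ)) * ((lookupQ TnL κ : ℚ) : ℝ)))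
          ≤ ((degLTList d mP).map fun β => ∑ κ ∈ degLT d m, (if ∑ μ, (β + κ) μ ≤ N₀ then (0 : ℝ) else
              monomial β (fun μ => ((h μ : ℚ) : ℝ)) * ((lookupQ zFL β : ℚ) : ℝ) * (monomial κ (fun μ => ((h μ : ℚ) : ℝ)) * ((lookupQ TnL κ : ℚ) : ℝ)))).sum :=
            sum_degLT_le_listSum mP _ fun β hβ => Finset.sum_nonneg fun κ hκ => hF0 β (hmemP β hβ) κ hκ
        _ ≤ (zFL.map fun e => (TnL.map fun e' => if ∑ μ, (e.1 μ + e'.1 μ) ≤ N₀ then (0 : ℝ) else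
              monomial e.1 (fun μ => ((h μ : ℚ) : ℝ)) * ((e.2 : ℚ) : ℝ) * (monomial e'.1 (fun μ => ((h μ : ℚ) : ℝ)) * ((e'.2 : ℚ) : ℝ))).sum).sum := by
            refine keyed_sum_le hzK _ _ fun e he => ?_
            have heP : e.1 ∈ degLT d mP := hmemP e.1 (hzK ▸ List.mem_map.mpr ⟨e, he, rfl⟩)
            calc ∑ κ ∈ degLT d m, (if ∑ μ, (e.1 + κ) μ ≤ N₀ then (0 : ℝ) else
                    monomial e.1 (fun μ => ((h μ : ℚ) : ℝ)) * ((lookupQ zFL e.1 : ℚ) : ℝ) * (monomial κ (fun μ => ((h μ : ℚ) : ℝ)) * ((lookupQ TnL κ : ℚ) : ℝ)))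
                ≤ ((degLTList d m).map fun κ => (if ∑ μ, (e.1 + κ) μ ≤ N₀ then (0 : ℝ) else
                    monomial e.1 (fun μ => ((h μ : ℚ) : ℝ)) * ((lookupQ zFL e.1 : ℚ) : ℝ) * (monomial κ (fun μ => ((h μ : ℚ) : ℝ)) * ((lookupQ TnL κ : ℚ) : ℝ)))).sum :=
                  sum_degLT_le_listSum m _ fun κ hκ => hF0 e.1 heP κ (hmemT κ hκ)
              _ ≤ (TnL.map fun e' => if ∑ μ, (e.1 μ + e'.1 μ) ≤ N₀ then (0 : ℝ) else
                    monomial e.1 (fun μ => ((h μ : ℚ) : ℝ)) * ((e.2 : ℚ) : ℝ) * (monomial e'.1 (fun μ => ((h μ : ℚ) : ℝ)) * ((e'.2 : ℚ) : ℝ))).sum := by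
                  refine keyed_sum_le hTK _ _ fun e' he' => ?_
                  rw [lookupQ_eq_of_mem (hzK ▸ nodup_degLTList d mP) he, lookupQ_eq_of_mem (hTK ▸ nodup_degLTList d m) he']
                  have e1 : (∑ μ, (e.1 + e'.1) μ ≤ N₀) ↔ (∑ μ, (e.1 μ + e'.1 μ) ≤ N₀) := by simp only [Pi.add_apply]
                  by_cases hcnd : ∑ μ, (e.1 μ + e'.1 μ) ≤ N₀
                  · rw [if_pos (e1.mpr hcnd), if_pos hcnd]
                  · rw [if_neg (fun h' => hcnd (e1.mp h')), if_neg hcnd]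

/-! ## §5 Kernel sanity checks of the enumeration (the engines' index counts) -/

/-- KERNEL: `|{β : |β| ≤ 5}| = 126` (T_P of the DCOEFF ∕ COEFF2 records) and `|{κ : |κ| ≤ 6}| = 210` (`degLT 3 7`), `|{γ : |γ| ≤ 8}| = 495`. [folklore] -/
theorem degLTList_lengths : (degLTList 3 6).length = 126 ∧ (degLTList 3 7).length = 210 ∧ (degLTList 3 9).length = 495 := by
  refine ⟨?_, ?_, ?_⟩ <;> decide +kernel

end

end Summit.QuantumFields.BalabanUV.Beta.ResolventBoxCertificate
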